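import Literature.MathematicalPhysics.QuantumFieldTheory.Balaban1983to89.B4Thm110ZeroBoxDeriv

/-!
# `Balaban1983to89.B4Lemma22ZeroBoxDerivDual` — B4 Lemma 2.2, inequality (2.17), PROVED at `A = 0` on RECTANGULAR
# PARALLELEPIPEDS for ALL scales `k ≥ 1` at the two corners `p = q` left open by `B4Thm110ZeroBoxDeriv`:
# `G_k(□)∂^{η*}_μ` at `p = q = ∞` (the print's (2.40)–(2.41) with `‖f‖_∞`) and `∂^η_μG_k(□)` at `p = q = 1` («by the
# duality argument»), i.e. the sums of the differenced kernel `η^{-1}(G(x′, x + ηe_μ) − G(x′, x))` over the BOND `x`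

**Source.** T. Bałaban, *Regularity and Decay of Lattice Green's Functions*, Commun. Math. Phys. **89**, 571–597 (1983)
(bib key `Balaban1983RegularityDecay`, «B4» of the 1983–89 series): p. 572 [PDF 2] (1.2)–(1.6), p. 573 [PDF 3] the
difference derivative `∂^η_μ`, pp. 577–578 [PDF 7–8] Lemma 2.2 (2.16)–(2.17), p. 582 [PDF 12] (2.34), Lemma 2.4
(2.35)–(2.37), p. 583 [PDF 13] the proof of (2.17): the duality remark, the representation (2.40) of `G_k(□)∂^{η*}_μ`
and (2.41), p. 584 [PDF 14] (journal page = PDF page + 570; renders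
`b2b-balaban-ref1/pages/1983-cmp89-regularity-decay/1983-cmp89-regularity-decay-p002-x2.png`, `-p003`, `-p007`, `-p008`,
`-p012`, `-p013`, `-p014-x2.png`, read as images).  A new leaf on top of `B4Thm110ZeroBoxDeriv` (the ROW-differenced
kernel: (1.10) derivative clause, (2.17) for `∂^η_μG_k(□)` at `p = q = ∞` and `G_k(□)∂^{η*}_μ` at `p = q = 1`), whose
weighted-sum toolkit `wsum`, the triple-product estimate `wsum_gCB_le` and the transported derivative block-row bound
`Gfine_blockRowDiff_bound` are USED BY NAME, as are `B4Thm110ZeroBox`'s scale-`j` objects `𝒢_j`, `A_j`, `B_j`, `C_j`, the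
recursion `Gfine_succ_sub` ((2.34) one step) and the base `boxOpR_L_inv_decay`; no existing module is touched; nothing of
B4 is asserted as a fact.

## WHAT IS PRINTED (verbatim; `≦` of the print written `≤`)

p. 572: «These are real-valued functions defined on pairs ⟨x, x′⟩ of nearest neighbour points of the lattice, called
bonds. We identify them with vector-valued functions defined on points of the lattice by the identity
A_{⟨x,x+ηe_μ⟩} = A_μ(x), where e_μ is a unit vector of μ^th axis.» […] «⟨φ, (−Δ^{η,N}_{A,Ω})φ⟩ = Σ_{b⊂Ω} η^d|(D^η_Aφ)(b)|²
= Σ_{b⊂Ω} η^d|η^{−1}(U(A_b)φ(b₊) − φ(b₋))|²,   (1.3)  where the summation is over the set of all bonds b = ⟨b₋, b₊⟩ with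
end-points b₋, b₊ in Ω.» […] «G_k(Ω, A) = (−Δ^{η,N}_{A,Ω} + m² + aP_k(A))^{−1},   (1.6)  where m² ≥ 0 and a is a positive
constant close to 1.»

p. 573: «[Of course ∂^η_μ is a difference derivative defined by (∂^η_μA)(x) = η^{−1}(A(x + ηe_μ) − A(x)).]»

pp. 577–578: «**Lemma 2.2.** Let a rectangular parallelepiped □ be a sum of few large blocks […], and let Ã be a regular
vector field configuration […]. Then for e sufficiently small and α < 1, there exists a constant c₁ depending on d, α
only, such that ‖G_k(□, Ã)f‖_{1,α} ≤ c₁‖f‖_∞,   (2.16)  and a constant c₂ depending on d, p₁, such that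
‖G_k(□, Ã)f‖_q, ‖D^η_{Ã,μ}G_k(□, Ã)f‖_q, ‖G_k(□, Ã)D^{η*}_{Ã,μ}f‖_q ≤ c₂‖f‖_p   (2.17)  for 1 ≤ p, q ≤ ∞, satisfying the
condition 1/p − 1/p₁ ≤ 1/q ≤ 1/p with p₁ > d.»

p. 582: «This proof is based on renormalization group equations (2.43) of [1] rescaled to the η-lattice:
G_k(□) = C^{(0),η}(□) + Σ_{j=1}^{k−1} a_j²(L^jη)^{−4}G_j^η(□)Q_j^*C^{(j),L^jη}(□)Q_jG_j^η(□).   (2.34)» […]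
«**Lemma 2.4.** There exist positive constants c₀, δ₀, and for α < 1, there exists a constant c₁, such that
|(G_j(□)Q_j^*)(x, y)|, |(∂^{L^{−j}}_μG_j(□)Q_j^*)(x, y)| ≤ c₀e^{−δ₀|x−y|},   (2.35) […] |C^{(j)}(□; y, y′)| ≤ c₀e^{−δ₀|y−y′|},
(2.37)  for arbitrary non-negative integer j, arbitrary, rectangular parallelepiped □ ⊂ L^{−j}Z^d built of large
blocks, and x, x′ ∈ □, y, y′ ∈ □^{(j)} = □∩Z^d.»

p. 583: «Now we will prove the inequality (2.17) for G_k(□). For q = p = ∞, it is a special case of (2.16), but for lack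
of dependence on α, and was proved above. For q = p = 1 we get it by duality argument, i.e. using the fact that the space
L^∞(□) is adjoint to L^1(□). The Riesz-Thorin Theorem implies it for arbitrary q = p from [1, ∞].» […] «Now we will prove
that the operators G_k(□), ∂^η_μG_k(□), G_k(□)∂^{η*}_μ are bounded operators from L^{p₁}(□) with p₁ > d to L^∞(□). We will
use again the representation (2.34). Let us consider for example the operator G_k(□)∂^{η*}_μ:
(G_k(□)∂^{η*}_μf)(x) = η(C^{(0)}(η^{−1}□)∂^{1*}_μf)(η^{−1}x)
 + Σ_{j=1}^{k−1} a_j²L^jη(G_j((L^jη)^{−1}□)Q_j^*C^{(j)}((L^jη)^{−1}□)Q_jG_j((L^jη)^{−1}□)∂^{L^{−j}*}_μf)((L^jη)^{−1}x).   (2.40)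
Hence |(G_k(□)∂^{η*}_μf)(x)| ≤ η2c₀O(1)η^{−d/p₁}‖f‖_{p₁}
 + Σ_{j=1}^{k−1} O(1)L^jη Σ_{y∈(L^jη)^{−1}□^{(j)}} e^{−δ₀|(L^jη)^{−1}x−y|}|(Q_jG_j((L^jη)^{−1}□)∂^{L^{−j}*}_μf)(y)|
 ≤ O(1)η^{1−d/p₁}‖f‖_{p₁} + Σ_{j=1}^{k−1} O(1)(L^jη)^{1−d/p₁}‖f‖_{p₁} ≤ c′₂‖f‖_{p₁}   (2.41)
for x ∈ □, p₁ > d, where the constant c′₂ is built of c₀, Σ_{x∈Z^d} e^{−δ₀|x|}, Σ_{j=1}^∞ (L^{−j})^{1−d/p₁}. Again by the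
duality argument we get that the operator G_k(□) and its first order derivatives are bounded operators from L^1(□) to
L^{p′₁}(□), p′₁^{−1} + p₁^{−1} = 1.» […] «Thus Lemma 2.2 is proved, or rather reduced to Lemma 2.4.»

p. 584: «This part of the argument is valid for an arbitrary rectangular parallelepiped □ built of unit blocks, so the
inequalities are valid for all such sets.»

## WHAT THIS FILE CERTIFIES (kernel-checked, zero `sorry`, no hypotheses; the lineage is USED BY NAME, not re-proved)

Write `fwd_μ x` for the forward `μ`-neighbour `x + e_μ` of a site `x` of the box when it is a site of the box, and
`fwd_μ x = x` otherwise (§1, `fwd`; so `φ(fwd_μ x) − φ(x)` is the bond difference `φ(b₊) − φ(b₋)` on the bonds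
`b = ⟨x, x + ηe_μ⟩ ⊂ □` and `0` where there is no bond).  For every dimension `d + 1`, every `L = ℓ + 1 ≥ 2` and every
window `a ∈ [a₋, a₊]` (`a₋ > 0`), `m² ∈ [0, m²₊]` there are `δ₀ > 0`, `c₀ > 0` such that for EVERY scale `k ≥ 1`
(`η = L^{-k}`), every `(a, m²)` in the window, every box `□ = Π_μ[0, M_μ)` with integer sides `M_μ ≥ 1`, every axis `μ`
and every site `x′` of `□ ∩ ηℤ^{d+1}`, the propagator `G = G_k(□) = (B4BoxCov237.boxOpR (L^k) a_k m² M)⁻¹` obeys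
* `lemma22_zero_box_Gdstar_roww` (§5, the master estimate — the BOND-variable twin of
  `B4Thm110ZeroBoxDeriv.thm110_zero_box_deriv_roww`): `Σ_x |L^k(G(x′, fwd_μ x) − G(x′, x))|·e^{δ₀η|x′−x|_∞} ≤ c₀`;
* `lemma22_zero_box_Gdstar_rowSum` / `…_Gdstar_sup` / `…_Gdstar_dist` (§6) — **(2.17) for `G_k(□)∂^{η*}_μ` at
  `p = q = ∞`, i.e. (2.41) with `‖f‖_∞`**: `Σ_x |L^k(G(x′, fwd_μ x) − G(x′, x))| ≤ c₀` and
  `|(G_k(□)∂^{η*}_μf)(x′)| = |Σ_x L^k(G(x′, fwd_μ x) − G(x′, x))f(x)| ≤ c₀e^{−δ₀ηD}‖f‖_∞` (`D ≤ dist` to `supp f`, e.g. `0`);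
* `lemma22_zero_box_deriv_colSum` / `…_deriv_l1` (§6) — **(2.17) for `∂^η_μG_k(□)` at `p = q = 1`** («duality», here the
  symmetry of `G`): `Σ_x |L^k(G(fwd_μ x, x′) − G(x, x′))| ≤ c₀` and `Σ_x |L^k((Gf)(fwd_μ x) − (Gf)(x))| ≤ c₀Σ_{x′}|f(x′)|`;
* `Gdstar_pairing` (§6) — the DICTIONARY CHECK that the operator so bounded is the adjoint one:
  `Σ_{x′} g(x′)·Σ_x L^k(G(x′,fwd_μ x) − G(x′,x))f(x) = Σ_x f(x)·L^k((Gg)(fwd_μ x) − (Gg)(x))`, i.e. `⟨g, G∂^*_μf⟩ = ⟨∂_μGg, f⟩`;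
* `lemma22_zero_box_Gdstar_roww_coeff` / `…_deriv_l1_coeff` (§6) — the same for the operator with the LITERAL coefficient
  `a` of (1.6) ranging over the window (instead of the running `a_k = B1.aSeq a L k`), and `fwd_eq_of_nbr` relating `fwd`
  to the neighbour-pair convention `xe.1 = x.1 + Pi.single μ 1` of `B4Thm110ZeroBoxDeriv`;
* §7: the statements are instantiated at `d + 1 = 4`, `L = 2`, `a ∈ [1/2, 2]`, `m² ∈ [0, 1]` and their binders are
  inhabited (`k = 1`, the unit cube, `x′ = 0`), so nothing is vacuous.
On the way: the forward-neighbour map and its metric bookkeeping (§1), the COLUMN-differenced transport of the derivative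
half of (2.35) — `|L^k(B_j(y′, fwd_μ x) − B_j(y′, x))| ≤ b_j^{-(d+1)}s_j^{-1}C′e^{−κ|blk x − y′|}` (§2, `BmatColDiff_bound`,
from `Gfine_blockRowDiff_bound` and the symmetry of `𝒢_j`), the column-differenced step bound `≤ Θe^{δ₀}L^{-(k-j)}` (§3,
`step_termDcol_bound` — the `j`-th term of (2.40)–(2.41) at `‖f‖_∞`, gain `L^jη`) and the induction over `j` (§4,
`Gfine_colwD_bound`).

## DICTIONARY (typist's; each line is a reading, not a quotation; everything at `A = 0`, `U ≡ 1`, one component;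
the dictionaries of `B4Thm110ZeroBox` / `B4Thm110ZeroBoxDeriv` for `□`, `G_k(□)`, `a_k`, (2.34), `∂^η_μ` apply verbatim)

* `∂^η_μ = D^η_{0,μ}` acts on functions on the sites of `□` along the bonds `⟨x, x + ηe_μ⟩ ⊂ □` ((1.3): BOTH end-points
  in `□`): `(∂^η_μφ)(x) = η^{-1}(φ(x + ηe_μ) − φ(x))` ↦ `L^k·(φ (fwd μ x) − φ x)`, which is the bond difference when
  `x + e_μ ∈ □` and `0` when it is not (no bond; `fwd μ x = x`).  Sums «over bonds» ↦ sums over all sites `x` of the box of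
  expressions that vanish when `fwd μ x = x`.
* `G_k(□)∂^{η*}_μ` (adjoint for the counting measures `η^d Σ_{sites}`, `η^d Σ_{bonds}`; `G` symmetric): its kernel ↦
  `(x′, x) ↦ L^k(G(x′, fwd_μ x) − G(x′, x))`, certified by the pairing identity `Gdstar_pairing`; `∂^η_μG_k(□)`: kernel
  `(x, x′) ↦ L^k(G(fwd_μ x, x′) − G(x, x′))`.
* `‖T‖_{∞→∞} = sup_{rows} Σ|kernel|`, `‖T‖_{1→1} = sup_{columns} Σ|kernel|` (the `η^d` weights of `L^p(□)` cancel in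
  (2.17) for `p = q`); «duality argument» (p. 583) ↦ `‖∂_μG‖_{1→1} = ‖(∂_μG)^*‖_{∞→∞} = ‖G∂^*_μ‖_{∞→∞}`, here the
  symmetry `G(x′, z) = G(z, x′)` (`B4BoxCov237.boxOpR_inv_isSymm`).
* (2.40)–(2.41), `j`-th term ↦ `α_j²·Σ_{y,y′} A_j(x′,y)C_j(y,y′)·L^k(B_j(y′, fwd_μ x) − B_j(y′, x))` (the recursion
  `Gfine_succ_sub` differenced in the COLUMN variable), the factor `L^jη = L^{-(k-j)} = s_j^{-1}` being the gain of the
  differenced block-row bound (2.35) (`Gfine_blockRowDiff_bound`); `p₁ = ∞`, `η^{−d/p₁} = 1`.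
* «constant c₂ depending on d, p₁» ↦ `∃ δ₀ c₀` depending on `d`, `ℓ` and the window only — uniform in `k ≥ 1`, in the
  box, in `μ`, in the base site and in `(a, m²)`.

## HONEST SCOPE — what is NOT certified here

(i) Only `A = 0` (`D^η_{Ã,μ} = ∂^η_μ`; «e sufficiently small», regularity of `Ã` void; one component).  (ii) Only
`□ = Π_μ[0, M_μ)` with integer sides (unions of UNIT blocks, p. 584).  (iii) Only the corners `p = q = ∞` for
`G_k(□)∂^{η*}_μ` and `p = q = 1` for `∂^η_μG_k(□)` of (2.17) (the other two corners and `G_k(□)` itself are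
`B4Thm110ZeroBoxDeriv` / `B4Thm110ZeroBox`); NOT `1 < p = q < ∞` (Riesz–Thorin), NOT the `L^{p₁} → L^∞` bound (2.41) for
finite `p₁ > d` nor its dual `L^1 → L^{p′₁}`, NOT the off-diagonal `(p, q)` of the figure on p. 583, NOT (2.16)/Hölder.
(iv) The constants are existential and depend on `d`, `ℓ` and the window; the weight is `δ₀` per unit of `η`-scaled sup
distance.  (v) ROUTE: the print's (2.40)–(2.41) at `‖f‖_∞` — (2.34) one step at a time differenced in the column (bond)
variable, the derivative half of (2.35) entering through the right factor `Q_jG_j∂^{L^{-j}*}_μ` (here: symmetry of `𝒢_j` +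
`Gfine_blockRowDiff_bound`), the value half (`Gfine_blockRow_bound`) and (2.37) (`cov237_box_decay`) as kernel-proved
inputs, `j = 1` start differenced crudely as in `B4Thm110ZeroBoxDeriv`; the `(1,1)` corner for `∂_μG` by symmetry.
(vi) This file does not touch `DagBinding`/`DagDischarged` (the carver's) nor `B4Prop31Zero`; whether anything abstract
of the binding is instantiated from it is the carver's call.

**Value = kernel certificate (two more corners of the print's (2.17) at `A = 0` on boxes, all scales, by the print's own
(2.40)–(2.41) route over the package's `A = 0` theorems), NOT summit progress**: the Yang–Mills / `Summit.QuantumFields`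
statements are untouched; no Literature fact is minted — every hypothesis used is kernel-proved in this package.
-/

namespace Literature.MathematicalPhysics.QuantumFieldTheory.Balaban1983to89.B4Lemma22ZeroBoxDerivDual

open Finset Matrix
open Literature.MathematicalPhysics.QuantumFieldTheory.Balaban1983to89.B4ContourShift
open Literature.MathematicalPhysics.QuantumFieldTheory.Balaban1983to89.B4Reflection242
open Literature.MathematicalPhysics.QuantumFieldTheory.Balaban1983to89.B4Green242Bridge
open Literature.MathematicalPhysics.QuantumFieldTheory.Balaban1983to89.B4BoxCov237
open Literature.MathematicalPhysics.QuantumFieldTheory.Balaban1983to89.B4Thm110ZeroBox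
open Literature.MathematicalPhysics.QuantumFieldTheory.Balaban1983to89.B4Thm110ZeroBoxDeriv
open B4Sect5Torus (IsPseudoDist SumBound Hyp56 rate rate_pos inv_decay)
open B4Sect5Proof (latticeConst latticeConst_nonneg latticeSum_le)

noncomputable section

variable {d : ℕ}

/-! ## §1 The forward neighbour `fwd_μ x` along the bonds of the box -/

section Fwd

variable {N : Fin (d + 1) → ℕ}

/-- the FORWARD `μ`-NEIGHBOUR of a site of the box `Π_μ[0,N_μ)`: `x + e_μ` if it is a site of the box (the bond
`⟨x, x + ηe_μ⟩ ⊂ □` of (1.3)), and `x` itself otherwise (no bond: every bond difference `φ(fwd x) − φ(x)` then vanishes).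
[folklore] -/
def fwd (N : Fin (d + 1) → ℕ) (μ : Fin (d + 1)) (x : ↥(boxDom N)) : ↥(boxDom N) :=
  if h : x.1 + Pi.single μ 1 ∈ boxDom N then ⟨x.1 + Pi.single μ 1, h⟩ else x

/-- the two cases of `fwd`. [folklore] -/
theorem fwd_spec (μ : Fin (d + 1)) (x : ↥(boxDom N)) :
    (fwd N μ x).1 = x.1 + Pi.single μ 1 ∨ fwd N μ x = x := by
  unfold fwd
  split_ifs with h
  · exact Or.inl rfl
  · exact Or.inr rfl

/-- when `x + e_μ` is a site of the box, `fwd_μ x = x + e_μ`. [folklore] -/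
theorem fwd_val_of_mem (μ : Fin (d + 1)) (x : ↥(boxDom N)) (h : x.1 + Pi.single μ 1 ∈ boxDom N) :
    (fwd N μ x).1 = x.1 + Pi.single μ 1 := by
  unfold fwd
  rw [dif_pos h]

/-- when it is not, `fwd_μ x = x`. [folklore] -/
theorem fwd_of_not_mem (μ : Fin (d + 1)) (x : ↥(boxDom N)) (h : x.1 + Pi.single μ 1 ∉ boxDom N) :
    fwd N μ x = x := by
  unfold fwd
  rw [dif_neg h]

/-- the neighbour-pair convention of `B4Thm110ZeroBoxDeriv` (`xe.1 = x.1 + Pi.single μ 1`) is the bond case of `fwd`.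
[folklore] -/
theorem fwd_eq_of_nbr (μ : Fin (d + 1)) (x xe : ↥(boxDom N)) (hxe : xe.1 = x.1 + Pi.single μ 1) : fwd N μ x = xe := by
  have h : x.1 + Pi.single μ 1 ∈ boxDom N := hxe ▸ xe.2
  exact Subtype.ext ((fwd_val_of_mem μ x h).trans hxe.symm)

/-- `|x′ − x|_∞ ≤ |x′ − fwd_μ x|_∞ + 1`. [folklore] -/
theorem supNorm_sub_le_sub_fwd (μ : Fin (d + 1)) (x' x : ↥(boxDom N)) :
    supNorm (x'.1 - x.1) ≤ supNorm (x'.1 - (fwd N μ x).1) + 1 := by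
  rcases fwd_spec μ x with h | h
  · have h1 := supNorm_nbr_sub_le (x' := x'.1) h
    rw [← neg_sub x'.1 (fwd N μ x).1, B4TorusKernel.supNorm_neg, ← neg_sub x'.1 x.1, B4TorusKernel.supNorm_neg] at h1
    have h2 := supNorm_sub_le_nbr (x' := x'.1) h
    rw [← neg_sub x'.1 (fwd N μ x).1, B4TorusKernel.supNorm_neg, ← neg_sub x'.1 x.1, B4TorusKernel.supNorm_neg] at h2
    exact h2
  · rw [h]
    linarith

end Fwd

/-- differencing a triple matrix product in the column index:
`t·((ACB)(p,z₁) − (ACB)(p,z₂)) = Σ_{y′}Σ_y A(p,y)·C(y,y′)·(t(B(y′,z₁) − B(y′,z₂)))`. [folklore] -/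
theorem mul3_col_sub {α β γ ε : Type*} [Fintype β] [Fintype γ] (A : Matrix α β ℝ) (C : Matrix β γ ℝ)
    (B : Matrix γ ε ℝ) (p : α) (z₁ z₂ : ε) (t : ℝ) :
    t * ((A * C * B) p z₁ - (A * C * B) p z₂) = ∑ y', ∑ y, A p y * C y y' * (t * (B y' z₁ - B y' z₂)) := by
  simp only [Matrix.mul_apply, Finset.sum_mul]
  rw [← Finset.sum_sub_distrib, Finset.mul_sum]
  refine Finset.sum_congr rfl fun y' _ => ?_
  rw [← Finset.sum_sub_distrib, Finset.mul_sum]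
  refine Finset.sum_congr rfl fun y _ => ?_
  ring

/-! ## §2 The right factor `Q_jG_j∂^{L^{-j}*}_μ` of (2.40): COLUMN-differenced transport of the derivative half of (2.35) -/

section ColDiff

variable {ℓ k j : ℕ}

/-- **THE COLUMN-DIFFERENCED `B_j = Q_j𝒢_j` DECAYS WITH THE GAIN `s_j^{-1}`**: for every block `y′` and every site `x`,
`|L^k(B_j(y′, fwd_μ x) − B_j(y′, x))| ≤ b_j^{-(d+1)}·s_j^{-1}C′·e^{−κ|blk_{b_j}x − y′|}` — by the symmetry of `𝒢_j` this is
`b_j^{-(d+1)}` times the differenced block-row sum of `B4Thm110ZeroBoxDeriv.Gfine_blockRowDiff_bound` at the base `x`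
(and `0` when `x` has no forward bond).  [cite: Balaban1983RegularityDecay, p. 582 Lemma 2.4 (2.35); p. 583 (2.40)] -/
theorem BmatColDiff_bound (d ℓ : ℕ) (hℓ : 1 ≤ ℓ) (aminus aplus m2plus : ℝ) (ha : 0 < aminus) :
    ∃ κ C : ℝ, 0 < κ ∧ 0 ≤ C ∧ ∀ (k j : ℕ), 1 ≤ j → ∀ (hj : j + 1 ≤ k), ∀ (a m2 : ℝ), aminus ≤ a → a ≤ aplus →
      0 ≤ m2 → m2 ≤ m2plus → ∀ (M : Fin (d + 1) → ℕ), (∀ i, 1 ≤ M i) →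
        ∀ (μ : Fin (d + 1)) (y' : ↥(boxDom (Mj ℓ k M j))) (x : ↥(boxDom (Nf ℓ k M))),
          |(((ℓ + 1) ^ k : ℕ) : ℝ) * (Bmat ℓ k M j a m2 y' (fwd (Nf ℓ k M) μ x) - Bmat ℓ k M j a m2 y' x)|
            ≤ ((((bj ℓ j : ℕ) : ℝ)) ^ (d + 1))⁻¹ *
                ((sc ℓ k j)⁻¹ * C * Real.exp (-(κ * supNorm (blk (bj ℓ j) x.1 - y'.1)))) := by
  obtain ⟨κ, C, hκ, hC, hDf⟩ := Gfine_blockRowDiff_bound d ℓ hℓ aminus aplus m2plus ha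
  refine ⟨κ, C, hκ, hC, fun k j hj1 hj a m2 h1 h2 h3 h4 M hM μ y' x => ?_⟩
  have hb1 : 1 ≤ bj ℓ j := bj_pos ℓ j
  have hbD : (0 : ℝ) < ((bj ℓ j : ℕ) : ℝ) ^ (d + 1) := by positivity
  have hs1i : 0 ≤ (sc ℓ k j)⁻¹ := (inv_pos.2 (sc_pos ℓ k j)).le
  -- `B_j(y′, z) = b^{-(d+1)} Σ_{w ∈ B(y′)} 𝒢_j(z, w)` (symmetry of `𝒢_j`)
  have hBe : ∀ z : ↥(boxDom (Nf ℓ k M)), Bmat ℓ k M j a m2 y' z = ((((bj ℓ j : ℕ) : ℝ)) ^ (d + 1))⁻¹ *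
      ∑ w, (if blk (bj ℓ j) w.1 = y'.1 then Gfine ℓ k M j a m2 z w else 0) := by
    intro z
    simp only [Bmat, Matrix.mul_apply, QkM, Matrix.of_apply, Finset.mul_sum]
    refine Finset.sum_congr rfl fun w _ => ?_
    split_ifs with hw
    · rw [(Gfine_isSymm ℓ k M j a m2).apply z w]
    · rw [zero_mul, mul_zero]
  rcases fwd_spec μ x with hxe | hxe
  · have hd := hDf k j hj1 hj a m2 h1 h2 h3 h4 M hM μ x (fwd (Nf ℓ k M) μ x) hxe y'.1 y'.2
    have heq : (((ℓ + 1) ^ k : ℕ) : ℝ) * (Bmat ℓ k M j a m2 y' (fwd (Nf ℓ k M) μ x) - Bmat ℓ k M j a m2 y' x)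
        = ((((bj ℓ j : ℕ) : ℝ)) ^ (d + 1))⁻¹ * ((((ℓ + 1) ^ k : ℕ) : ℝ) * ∑ w : ↥(boxDom (Nf ℓ k M)),
            (if blk (bj ℓ j) w.1 = y'.1 then
              Gfine ℓ k M j a m2 (fwd (Nf ℓ k M) μ x) w - Gfine ℓ k M j a m2 x w else 0)) := by
      rw [hBe, hBe, ← mul_sub, ← Finset.sum_sub_distrib]
      have hin : ∀ w : ↥(boxDom (Nf ℓ k M)),
          ((if blk (bj ℓ j) w.1 = y'.1 then Gfine ℓ k M j a m2 (fwd (Nf ℓ k M) μ x) w else 0)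
            - if blk (bj ℓ j) w.1 = y'.1 then Gfine ℓ k M j a m2 x w else 0)
          = (if blk (bj ℓ j) w.1 = y'.1 then
              Gfine ℓ k M j a m2 (fwd (Nf ℓ k M) μ x) w - Gfine ℓ k M j a m2 x w else 0) := by
        intro w
        split_ifs <;> ring
      rw [Finset.sum_congr rfl fun w _ => hin w]
      ring
    rw [heq, abs_mul, abs_of_pos (inv_pos.2 hbD)]
    exact mul_le_mul_of_nonneg_left hd (inv_pos.2 hbD).le
  · rw [hxe, sub_self, mul_zero, abs_zero]
    exact mul_nonneg (inv_pos.2 hbD).le (mul_nonneg (mul_nonneg hs1i hC) (Real.exp_pos _).le)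

end ColDiff

/-! ## §3 The `j`-th term of (2.40)–(2.41) at `‖f‖_∞`: the column-differenced step bound `≤ Θe^{δ₀}L^{-(k-j)}` -/

section StepBound

variable {ℓ k j : ℕ}

set_option maxHeartbeats 1600000 in
/-- **THE COLUMN-DIFFERENCED STEP BOUND**: there are `κ₀ > 0`, `Θ ≥ 0` (depending on `d, ℓ` and the window only) such
that for every weight rate `0 ≤ δ₀ ≤ κ₀`, every `1 ≤ j < k`, every point of the window, every box, every axis `μ` and every
site `x′` of the fine box:
`Σ_x L^k|(𝒢_{j+1} − 𝒢_j)(x′, fwd_μ x) − (𝒢_{j+1} − 𝒢_j)(x′, x)|·e^{δ₀|x′−x|_∞/L^k} ≤ Θe^{δ₀}·L^{-(k-j)}` — the `j`-th term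
of (2.41) with `p₁ = ∞` (gain `L^jη`). [cite: Balaban1983RegularityDecay, p. 583 (2.40)–(2.41)] -/
theorem step_termDcol_bound (d ℓ : ℕ) (hℓ : 1 ≤ ℓ) (amin aplus m2plus : ℝ) (ha : 0 < amin) :
    ∃ κ₀ Θ : ℝ, 0 < κ₀ ∧ 0 ≤ Θ ∧ ∀ (δ₀ : ℝ), 0 ≤ δ₀ → δ₀ ≤ κ₀ →
      ∀ (k j : ℕ), 1 ≤ j → ∀ (hj : j + 1 ≤ k), ∀ (a m2 : ℝ), amin ≤ a → a ≤ aplus → 0 ≤ m2 →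
        m2 ≤ m2plus → ∀ (M : Fin (d + 1) → ℕ), (∀ i, 1 ≤ M i) →
        ∀ (μ : Fin (d + 1)) (x' : ↥(boxDom (Nf ℓ k M))),
          wsum δ₀ ((ℓ + 1) ^ k) x' (fun x => (((ℓ + 1) ^ k : ℕ) : ℝ) *
              ((Gfine ℓ k M (j + 1) a m2 - Gfine ℓ k M j a m2) x' (fwd (Nf ℓ k M) μ x)
                - (Gfine ℓ k M (j + 1) a m2 - Gfine ℓ k M j a m2) x' x))
            ≤ Θ * Real.exp δ₀ * (sc ℓ k j)⁻¹ := by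
  obtain ⟨κ, C₁, hκ, hC₁, hR⟩ := Gfine_blockRow_bound d ℓ hℓ amin aplus m2plus ha
  obtain ⟨κ', C', hκ', hC', hDc⟩ := BmatColDiff_bound d ℓ hℓ amin aplus m2plus ha
  obtain ⟨δ, c₂, hδ, hc₂, hCov⟩ := cov237_box_decay d ℓ hℓ (amin * (1 - ((((ℓ : ℝ) + 1)) ^ 2)⁻¹)) aplus
    m2plus amin aplus (aminus'_pos hℓ ha) ha
  have hK0 : ∀ t : ℝ, 0 < t → 0 ≤ latticeConst (d + 1) t := fun t ht => latticeConst_nonneg _ ht.le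
  have hκ₁ : 0 < min κ κ' := lt_min hκ hκ'
  have hKκ := hK0 _ (half_pos hκ₁)
  have hKδ := hK0 _ (half_pos hδ)
  refine ⟨min (min κ κ') δ / 2, aplus ^ 2 * (C₁ * c₂ * C')
      * (latticeConst (d + 1) (min κ κ' / 2) * latticeConst (d + 1) (δ / 2)
          * latticeConst (d + 1) (min κ κ' / 2)),
    by positivity, ?_, ?_⟩
  · exact mul_nonneg (mul_nonneg (sq_nonneg _) (mul_nonneg (mul_nonneg hC₁ hc₂.le) hC'))
      (mul_nonneg (mul_nonneg hKκ hKδ) hKκ)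
  intro δ₀ hδ0 hδ1 k j hj1 hj a m2 h1 h2 h3 h4 M hM μ x'
  have ha0 : 0 < a := lt_of_lt_of_le ha h1
  obtain ⟨hw1, hw2, hapos⟩ := aSeq_window hℓ ha h1 h2 hj1
  have hs : 0 < sc ℓ k j ^ 2 := pow_pos (sc_pos ℓ k j) 2
  have hsi : 0 < (sc ℓ k j ^ 2)⁻¹ := inv_pos.2 hs
  have hs1i : 0 < (sc ℓ k j)⁻¹ := inv_pos.2 (sc_pos ℓ k j)
  have hsc0 : sc ℓ k j ≠ 0 := (sc_pos ℓ k j).ne'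
  have hm' : 0 ≤ m2 / sc ℓ k j ^ 2 := div_nonneg h3 hs.le
  have hm'' : m2 / sc ℓ k j ^ 2 ≤ m2plus :=
    (div_le_self h3 (one_le_pow₀ (one_le_sc ℓ k j))).trans h4
  have hb1 : 1 ≤ bj ℓ j := bj_pos ℓ j
  have hbD : (0 : ℝ) < ((bj ℓ j : ℕ) : ℝ) ^ (d + 1) := by positivity
  have hδκ : δ₀ ≤ min κ κ' / 2 := hδ1.trans (by linarith [min_le_left (min κ κ') δ])
  have hδδ : δ₀ ≤ δ / 2 := hδ1.trans (by linarith [min_le_right (min κ κ') δ])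
  -- the row `g(y) = A_j(x′, y)` of block-row sums at the base `x′`
  have hg : ∀ y : ↥(boxDom (Mj ℓ k M j)),
      |Amat ℓ k M j a m2 x' y| ≤ (sc ℓ k j ^ 2)⁻¹ * C₁ * Real.exp (-(min κ κ' * supNorm (blk (bj ℓ j) x'.1 - y.1))) := by
    intro y
    have hAe : Amat ℓ k M j a m2 x' y
        = ∑ w, (if blk (bj ℓ j) w.1 = y.1 then Gfine ℓ k M j a m2 x' w else 0) := by
      simp only [Amat, Matrix.mul_apply, QksM, Matrix.of_apply, mul_ite, mul_one, mul_zero]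
    rw [hAe]
    exact (hR k j hj1 hj a m2 h1 h2 h3 h4 M hM x' y.1 y.2).trans
      (mul_le_mul_of_nonneg_left (exp_rate_mono (min_le_left κ κ') (supNorm_nonneg _))
        (mul_nonneg hsi.le hC₁))
  -- the column-differenced right factor `B′(y′, x) = L^k(B_j(y′, fwd x) − B_j(y′, x))`
  have hB : ∀ (y' : ↥(boxDom (Mj ℓ k M j))) (x : ↥(boxDom (Nf ℓ k M))),
      |(Matrix.of fun (y' : ↥(boxDom (Mj ℓ k M j))) (x : ↥(boxDom (Nf ℓ k M))) =>
          (((ℓ + 1) ^ k : ℕ) : ℝ) * (Bmat ℓ k M j a m2 y' (fwd (Nf ℓ k M) μ x) - Bmat ℓ k M j a m2 y' x)) y' x|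
        ≤ ((((bj ℓ j : ℕ) : ℝ)) ^ (d + 1))⁻¹ *
          ((sc ℓ k j)⁻¹ * C' * Real.exp (-(min κ κ' * supNorm (blk (bj ℓ j) x.1 - y'.1)))) := by
    intro y' x
    rw [Matrix.of_apply]
    exact (hDc k j hj1 hj a m2 h1 h2 h3 h4 M hM μ y' x).trans
      (mul_le_mul_of_nonneg_left
        (mul_le_mul_of_nonneg_left (exp_rate_mono (min_le_right κ κ') (supNorm_nonneg _))
          (mul_nonneg hs1i.le hC'))
        (inv_pos.2 hbD).le)
  have hC : ∀ (y y' : ↥(boxDom (Mj ℓ k M j))),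
      |Cmat ℓ k M j a m2 y y'| ≤ (sc ℓ k j ^ 2)⁻¹ * c₂ * Real.exp (-(δ * supNorm (y.1 - y'.1))) := by
    intro y y'
    have h := (hCov (bj ℓ j) hb1 _ _ a hw1 hw2 hm' hm'' h1 h2 (Mp ℓ k M j) (Mp_pos hM)).2 y y'
    rw [Cmat, Matrix.smul_apply, smul_eq_mul, abs_mul, abs_of_pos hsi, mul_assoc]
    exact mul_le_mul_of_nonneg_left h hsi.le
  -- the triple-product estimate of `B4Thm110ZeroBoxDeriv` §2, base point `x′`, summed over the bond variable `x`
  have htri := wsum_gCB_le hj M x' (fun y => Amat ℓ k M j a m2 x' y) (Cmat ℓ k M j a m2)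
    (Matrix.of fun (y' : ↥(boxDom (Mj ℓ k M j))) (x : ↥(boxDom (Nf ℓ k M))) =>
      (((ℓ + 1) ^ k : ℕ) : ℝ) * (Bmat ℓ k M j a m2 y' (fwd (Nf ℓ k M) μ x) - Bmat ℓ k M j a m2 y' x))
    (mul_nonneg hsi.le hC₁) (mul_nonneg hsi.le hc₂.le) (mul_nonneg hs1i.le hC') hκ₁ hδ hδ0 hδκ hδδ hg hC hB
  -- `L^k·(column-differenced row x′ of α_j²A_jC_jB_j) = α_j²·Σ_{y′,y} A_j C_j B′`
  have hfun : (fun x => (((ℓ + 1) ^ k : ℕ) : ℝ) *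
        ((Gfine ℓ k M (j + 1) a m2 - Gfine ℓ k M j a m2) x' (fwd (Nf ℓ k M) μ x)
          - (Gfine ℓ k M (j + 1) a m2 - Gfine ℓ k M j a m2) x' x))
      = fun x => αj a ℓ k j ^ 2 * ∑ y', ∑ y, Amat ℓ k M j a m2 x' y * Cmat ℓ k M j a m2 y y'
          * (Matrix.of fun (y' : ↥(boxDom (Mj ℓ k M j))) (x : ↥(boxDom (Nf ℓ k M))) =>
              (((ℓ + 1) ^ k : ℕ) : ℝ) *
                (Bmat ℓ k M j a m2 y' (fwd (Nf ℓ k M) μ x) - Bmat ℓ k M j a m2 y' x)) y' x := by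
    funext x
    simp only [Matrix.of_apply]
    rw [Gfine_succ_sub hℓ hj1 hj hM ha0 h3, Matrix.smul_apply, Matrix.smul_apply, smul_eq_mul, smul_eq_mul,
      ← mul_sub, mul_left_comm, mul3_col_sub]
  have hα : αj a ℓ k j ^ 2 ≤ aplus ^ 2 * (sc ℓ k j ^ 2) ^ 2 := by
    unfold αj
    rw [mul_pow]
    exact mul_le_mul_of_nonneg_right (pow_le_pow_left₀ hapos.le hw2 2) (by positivity)
  rw [hfun, wsum_mul_left _ _ _ (sq_nonneg _)]
  calc αj a ℓ k j ^ 2 * wsum δ₀ ((ℓ + 1) ^ k) x' (fun x => ∑ y', ∑ y,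
          Amat ℓ k M j a m2 x' y * Cmat ℓ k M j a m2 y y'
            * (Matrix.of fun (y' : ↥(boxDom (Mj ℓ k M j))) (x : ↥(boxDom (Nf ℓ k M))) =>
                (((ℓ + 1) ^ k : ℕ) : ℝ) *
                  (Bmat ℓ k M j a m2 y' (fwd (Nf ℓ k M) μ x) - Bmat ℓ k M j a m2 y' x)) y' x)
      ≤ (aplus ^ 2 * (sc ℓ k j ^ 2) ^ 2) *
          ((sc ℓ k j ^ 2)⁻¹ * C₁ * ((sc ℓ k j ^ 2)⁻¹ * c₂) * ((sc ℓ k j)⁻¹ * C') * Real.exp δ₀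
          * (latticeConst (d + 1) (min κ κ' / 2) * latticeConst (d + 1) (δ / 2)
              * latticeConst (d + 1) (min κ κ' / 2))) :=
        mul_le_mul hα htri (wsum_nonneg _ _ _ _) (by positivity)
    _ = aplus ^ 2 * (C₁ * c₂ * C')
          * (latticeConst (d + 1) (min κ κ' / 2) * latticeConst (d + 1) (δ / 2)
              * latticeConst (d + 1) (min κ κ' / 2))
          * Real.exp δ₀ * (sc ℓ k j)⁻¹ := by
        field_simp

end StepBound

/-! ## §4 The induction over `j`: `Σ_x L^k|𝒢_j(x′, fwd_μ x) − 𝒢_j(x′, x)|e^{δ₀|x′−x|/L^k} ≤ B + Θe^{δ₀}Σ_{i<j}L^{-(k-i)}` -/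

set_option maxHeartbeats 1600000 in
/-- **WEIGHTED BOND SUMS OF THE COLUMN-DIFFERENCED `𝒢_j`, UNIFORMLY IN `j ≤ k`** ((2.40)–(2.41) summed up to `j`,
`p₁ = ∞`): there are `δ₀ > 0` and `c₀` such that for all `1 ≤ j ≤ k`, every point of the window, every box, every axis
and every site `x′`: `Σ_x |L^k(𝒢_j(x′, fwd_μ x) − 𝒢_j(x′, x))|e^{δ₀|x′−x|_∞/L^k} ≤ c₀`.  The `j = 1` start is the one-step
box Green's function differenced crudely (`L^k·s_1^{-2} ≤ L`), the step is §3, and `Σ_{i<j}L^{-(k-i)} ≤ 1`.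
[cite: Balaban1983RegularityDecay, p. 583 (2.40)–(2.41)] -/
theorem Gfine_colwD_bound (d ℓ : ℕ) (hℓ : 1 ≤ ℓ) (amin aplus m2plus : ℝ) (ha : 0 < amin) :
    ∃ δ₀ c₀ : ℝ, 0 < δ₀ ∧ 0 < c₀ ∧ ∀ (k : ℕ), 1 ≤ k → ∀ (j : ℕ), 1 ≤ j → j ≤ k →
      ∀ (a m2 : ℝ), amin ≤ a → a ≤ aplus → 0 ≤ m2 → m2 ≤ m2plus → ∀ (M : Fin (d + 1) → ℕ),
        (∀ i, 1 ≤ M i) → ∀ (μ : Fin (d + 1)) (x' : ↥(boxDom (Nf ℓ k M))),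
          wsum δ₀ ((ℓ + 1) ^ k) x' (fun x => (((ℓ + 1) ^ k : ℕ) : ℝ) *
              (Gfine ℓ k M j a m2 x' (fwd (Nf ℓ k M) μ x) - Gfine ℓ k M j a m2 x' x)) ≤ c₀ := by
  obtain ⟨r, C₀, hr, hC₀, hdec⟩ := boxOpR_L_inv_decay d ℓ hℓ (amin * (1 - ((((ℓ : ℝ) + 1)) ^ 2)⁻¹))
    aplus m2plus (aminus'_pos hℓ ha)
  obtain ⟨κ₀, Θ, hκ₀, hΘ, hstep⟩ := step_termDcol_bound d ℓ hℓ amin aplus m2plus ha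
  set δ₀ : ℝ := min (r / 2) κ₀ with hδ₀
  have hδ0 : 0 < δ₀ := lt_min (half_pos hr) hκ₀
  have hδr : δ₀ ≤ r / 2 := min_le_left _ _
  have hδκ : δ₀ ≤ κ₀ := min_le_right _ _
  have hK1 := one_le_latticeConst d (half_pos hr)
  have hL0 : (0 : ℝ) < (ℓ : ℝ) + 1 := by positivity
  set B₁ : ℝ := ((ℓ : ℝ) + 1) * C₀ * (Real.exp r + 1) * latticeConst (d + 1) (r / 2) with hB₁
  have hB₁0 : 0 < B₁ := by positivity
  refine ⟨δ₀, B₁ + Θ * Real.exp δ₀, hδ0, by positivity, ?_⟩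
  intro k hk j hj1 hjk a m2 h1 h2 h3 h4 M hM
  have ha0 : 0 < a := lt_of_lt_of_le ha h1
  have hL := one_lt_L_real hℓ
  set q : ℝ := (((ℓ : ℝ) + 1))⁻¹ with hq
  have hL2 : (2 : ℝ) ≤ (ℓ : ℝ) + 1 := by
    have : (1 : ℝ) ≤ ℓ := by exact_mod_cast hℓ
    linarith
  have hq0 : 0 < q := by positivity
  have hq2 : q ≤ 1 / 2 := by
    rw [hq]
    calc (((ℓ : ℝ) + 1))⁻¹ ≤ (2 : ℝ)⁻¹ := inv_anti₀ (by norm_num) hL2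
      _ = 1 / 2 := by norm_num
  have hq1 : 0 < 1 - q := by linarith
  have hnk : 1 ≤ (ℓ + 1) ^ k := Nat.one_le_pow _ _ (by omega)
  have hn0 : (0 : ℝ) ≤ (((ℓ + 1) ^ k : ℕ) : ℝ) := Nat.cast_nonneg _
  -- the base: entries of `𝒢_1`, scaled by `L^k`
  obtain ⟨hw1, hw2, hapos⟩ := aSeq_window hℓ ha h1 h2 (le_refl 1)
  have hT : ∀ p q' : ↥(boxDom (Nf ℓ k M)),
      (((ℓ + 1) ^ k : ℕ) : ℝ) * |Gfine ℓ k M 1 a m2 p q'|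
        ≤ ((ℓ : ℝ) + 1) * C₀ * Real.exp (-(r * supNorm (p.1 - q'.1))) := by
    intro p q'
    rcases Nat.lt_or_ge k 2 with hk2 | hk2
    · obtain rfl : k = 1 := by omega
      have hG : Gfine ℓ 1 M 1 a m2 = (boxOpR ((ℓ + 1) ^ 1) (B1.aSeq a ((ℓ : ℝ) + 1) 1) m2 M)⁻¹ := by
        unfold Gfine
        rw [fineOp_top]
      rw [hG]
      have hd := hdec ((ℓ + 1) ^ 1) (pow_one _) _ _ hw1 hw2 h3 h4 M p q'
      have hc1 : (((ℓ + 1) ^ 1 : ℕ) : ℝ) = (ℓ : ℝ) + 1 := by push_cast; ring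
      rw [hc1, mul_assoc]
      exact mul_le_mul_of_nonneg_left hd hL0.le
    · have hs : 0 < sc ℓ k 1 ^ 2 := pow_pos (sc_pos ℓ k 1) 2
      have hm' : 0 ≤ m2 / sc ℓ k 1 ^ 2 := div_nonneg h3 hs.le
      have hm'' : m2 / sc ℓ k 1 ^ 2 ≤ m2plus :=
        (div_le_self h3 (one_le_pow₀ (one_le_sc ℓ k 1))).trans h4
      rw [Gfine_apply hℓ (le_refl 1) hk2 hM ha0 h3 p q', abs_mul, abs_of_pos (inv_pos.2 hs), ← mul_assoc]
      have hd := hdec (bj ℓ 1) (pow_one _) _ _ hw1 hw2 hm' hm'' (Mj ℓ k M 1)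
        ((ej ℓ k M 1 hk2).symm p) ((ej ℓ k M 1 hk2).symm q')
      calc (((ℓ + 1) ^ k : ℕ) : ℝ) * (sc ℓ k 1 ^ 2)⁻¹ *
            |(boxOpR (bj ℓ 1) (B1.aSeq a ((ℓ : ℝ) + 1) 1) (m2 / sc ℓ k 1 ^ 2)
              (Mj ℓ k M 1))⁻¹ ((ej ℓ k M 1 hk2).symm p) ((ej ℓ k M 1 hk2).symm q')|
          ≤ ((ℓ : ℝ) + 1) * (C₀ * Real.exp (-(r * supNorm (p.1 - q'.1)))) :=
            mul_le_mul (Lk_mul_sc_one_sq_inv_le hk) hd (abs_nonneg _) hL0.le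
        _ = _ := by ring
  -- the base: the column-differenced rows
  have hTD : ∀ (μ : Fin (d + 1)) (x' x : ↥(boxDom (Nf ℓ k M))),
      |(((ℓ + 1) ^ k : ℕ) : ℝ) * (Gfine ℓ k M 1 a m2 x' (fwd (Nf ℓ k M) μ x) - Gfine ℓ k M 1 a m2 x' x)|
        ≤ ((ℓ : ℝ) + 1) * C₀ * (Real.exp r + 1) * Real.exp (-(r * supNorm (x'.1 - x.1))) := by
    intro μ x' x
    have h1' := hT x' (fwd (Nf ℓ k M) μ x)
    have h2' := hT x' x
    have hnb := supNorm_sub_le_sub_fwd μ x' x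
    have he : Real.exp (-(r * supNorm (x'.1 - (fwd (Nf ℓ k M) μ x).1)))
        ≤ Real.exp r * Real.exp (-(r * supNorm (x'.1 - x.1))) := by
      rw [← Real.exp_add]
      exact Real.exp_le_exp.2 (by nlinarith)
    have hLC : 0 ≤ ((ℓ : ℝ) + 1) * C₀ := by positivity
    calc |(((ℓ + 1) ^ k : ℕ) : ℝ) * (Gfine ℓ k M 1 a m2 x' (fwd (Nf ℓ k M) μ x) - Gfine ℓ k M 1 a m2 x' x)|
        = (((ℓ + 1) ^ k : ℕ) : ℝ) * |Gfine ℓ k M 1 a m2 x' (fwd (Nf ℓ k M) μ x) - Gfine ℓ k M 1 a m2 x' x| := by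
          rw [abs_mul, abs_of_nonneg hn0]
      _ ≤ (((ℓ + 1) ^ k : ℕ) : ℝ) *
            (|Gfine ℓ k M 1 a m2 x' (fwd (Nf ℓ k M) μ x)| + |Gfine ℓ k M 1 a m2 x' x|) :=
          mul_le_mul_of_nonneg_left (abs_sub _ _) hn0
      _ = (((ℓ + 1) ^ k : ℕ) : ℝ) * |Gfine ℓ k M 1 a m2 x' (fwd (Nf ℓ k M) μ x)|
            + (((ℓ + 1) ^ k : ℕ) : ℝ) * |Gfine ℓ k M 1 a m2 x' x| := mul_add _ _ _
      _ ≤ ((ℓ : ℝ) + 1) * C₀ * Real.exp (-(r * supNorm (x'.1 - (fwd (Nf ℓ k M) μ x).1)))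
            + ((ℓ : ℝ) + 1) * C₀ * Real.exp (-(r * supNorm (x'.1 - x.1))) := add_le_add h1' h2'
      _ ≤ ((ℓ : ℝ) + 1) * C₀ * (Real.exp r * Real.exp (-(r * supNorm (x'.1 - x.1))))
            + ((ℓ : ℝ) + 1) * C₀ * Real.exp (-(r * supNorm (x'.1 - x.1))) :=
          add_le_add (mul_le_mul_of_nonneg_left he hLC) le_rfl
      _ = _ := by ring
  -- the inductive claim
  have main : ∀ j, 1 ≤ j → j ≤ k → ∀ (μ : Fin (d + 1)) (x' : ↥(boxDom (Nf ℓ k M))),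
      wsum δ₀ ((ℓ + 1) ^ k) x' (fun x => (((ℓ + 1) ^ k : ℕ) : ℝ) *
          (Gfine ℓ k M j a m2 x' (fwd (Nf ℓ k M) μ x) - Gfine ℓ k M j a m2 x' x))
        ≤ B₁ + Θ * Real.exp δ₀ * (q * (sc ℓ k j)⁻¹ / (1 - q)) := by
    intro j hj1
    induction j, hj1 using Nat.le_induction with
    | base =>
      intro _ μ x'
      have hB0 : 0 ≤ ((ℓ : ℝ) + 1) * C₀ * (Real.exp r + 1) := by positivity
      calc wsum δ₀ ((ℓ + 1) ^ k) x' (fun x => (((ℓ + 1) ^ k : ℕ) : ℝ) *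
              (Gfine ℓ k M 1 a m2 x' (fwd (Nf ℓ k M) μ x) - Gfine ℓ k M 1 a m2 x' x))
          ≤ ((ℓ : ℝ) + 1) * C₀ * (Real.exp r + 1) * latticeConst (d + 1) (r / 2) :=
            wsum_le_of_decay hnk x' hB0 hr hδ0.le hδr (hTD μ x')
        _ ≤ B₁ + Θ * Real.exp δ₀ * (q * (sc ℓ k 1)⁻¹ / (1 - q)) := by
            rw [hB₁]
            have : 0 ≤ Θ * Real.exp δ₀ * (q * (sc ℓ k 1)⁻¹ / (1 - q)) := by
              have := sc_pos ℓ k 1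
              positivity
            linarith
    | succ j hj1 ih =>
      intro hjk μ x'
      have hprev := ih (by omega) μ x'
      have hst := hstep δ₀ hδ0.le hδκ k j hj1 hjk a m2 h1 h2 h3 h4 M hM μ x'
      have hsplit : (fun x => (((ℓ + 1) ^ k : ℕ) : ℝ) *
            (Gfine ℓ k M (j + 1) a m2 x' (fwd (Nf ℓ k M) μ x) - Gfine ℓ k M (j + 1) a m2 x' x))
          = fun x => (((ℓ + 1) ^ k : ℕ) : ℝ) *
              ((Gfine ℓ k M (j + 1) a m2 - Gfine ℓ k M j a m2) x' (fwd (Nf ℓ k M) μ x)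
                - (Gfine ℓ k M (j + 1) a m2 - Gfine ℓ k M j a m2) x' x)
            + (((ℓ + 1) ^ k : ℕ) : ℝ) *
              (Gfine ℓ k M j a m2 x' (fwd (Nf ℓ k M) μ x) - Gfine ℓ k M j a m2 x' x) := by
        funext x
        simp only [Matrix.sub_apply]
        ring
      rw [hsplit]
      calc wsum δ₀ ((ℓ + 1) ^ k) x' (fun x => (((ℓ + 1) ^ k : ℕ) : ℝ) *
              ((Gfine ℓ k M (j + 1) a m2 - Gfine ℓ k M j a m2) x' (fwd (Nf ℓ k M) μ x)
                - (Gfine ℓ k M (j + 1) a m2 - Gfine ℓ k M j a m2) x' x)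
            + (((ℓ + 1) ^ k : ℕ) : ℝ) *
              (Gfine ℓ k M j a m2 x' (fwd (Nf ℓ k M) μ x) - Gfine ℓ k M j a m2 x' x))
          ≤ wsum δ₀ ((ℓ + 1) ^ k) x' (fun x => (((ℓ + 1) ^ k : ℕ) : ℝ) *
              ((Gfine ℓ k M (j + 1) a m2 - Gfine ℓ k M j a m2) x' (fwd (Nf ℓ k M) μ x)
                - (Gfine ℓ k M (j + 1) a m2 - Gfine ℓ k M j a m2) x' x))
            + wsum δ₀ ((ℓ + 1) ^ k) x' (fun x => (((ℓ + 1) ^ k : ℕ) : ℝ) *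
              (Gfine ℓ k M j a m2 x' (fwd (Nf ℓ k M) μ x) - Gfine ℓ k M j a m2 x' x)) :=
            wsum_add_le _ _ _ _ _
        _ ≤ Θ * Real.exp δ₀ * (sc ℓ k j)⁻¹ + (B₁ + Θ * Real.exp δ₀ * (q * (sc ℓ k j)⁻¹ / (1 - q))) :=
            add_le_add hst hprev
        _ = B₁ + Θ * Real.exp δ₀ * (q * (sc ℓ k (j + 1))⁻¹ / (1 - q)) := by
            rw [sc_inv_succ hjk, ← hq]
            field_simp
            ring
  intro μ x'
  have hm := main j hj1 hjk μ x'
  have hs1 : (sc ℓ k j)⁻¹ ≤ 1 := inv_le_one_of_one_le₀ (one_le_sc ℓ k j)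
  have hs0 : 0 < (sc ℓ k j)⁻¹ := inv_pos.2 (sc_pos ℓ k j)
  have hgeo : q * (sc ℓ k j)⁻¹ / (1 - q) ≤ 1 := by
    rw [div_le_one hq1]
    calc q * (sc ℓ k j)⁻¹ ≤ q * 1 := mul_le_mul_of_nonneg_left hs1 hq0.le
      _ ≤ 1 - q := by linarith
  have hΘe : 0 ≤ Θ * Real.exp δ₀ := by positivity
  have hfin := mul_le_of_le_one_right hΘe hgeo
  linarith

/-! ## §5 (2.17)/(2.41) at `A = 0` for boxes: the weighted bond sums of `η^{-1}(G(x′, x + ηe_μ) − G(x′, x))` -/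

/-- **[B4] LEMMA 2.2 (2.17) FOR `G_k(□)∂^{η*}_μ` AT `A = 0`, rectangular parallelepipeds, weighted master form of the
`p = q = ∞` corner ((2.41) with `p₁ = ∞`)**: there are `δ₀ > 0`, `c₀ > 0` depending only on `d`, `L = ℓ + 1` and the
window such that for every `k ≥ 1` (`η = L^{-k}`), every `(a, m²)` in the window, every box `□ = Π_μ[0, M_μ)`
(`M_μ ≥ 1`), every axis `μ` and every site `x′` of `□`:
`Σ_{x ∈ □} |η^{-1}(G(□; x′, fwd_μ x) − G(□; x′, x))|·e^{δ₀·dist(x′,x)} ≤ c₀`,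
`G(□) = (−Δ^{η,N}_□ + m² + a_kP_k)^{-1}` at `A = 0` in values form (`a ↤ a_k`), `fwd_μ x = x + e_μ` on the bonds of `□`
(else `x`, zero term), `dist = |·|_∞/L^k`.  HONEST LABEL: proved by the print's (2.40)–(2.41) route at `A = 0` over the
package's kernel theorems.  [cite: Balaban1983RegularityDecay, pp. 577–578 Lemma 2.2 (2.17); p. 583 (2.40)–(2.41)] -/
theorem lemma22_zero_box_Gdstar_roww (d ℓ : ℕ) (hℓ : 1 ≤ ℓ) (amin aplus m2plus : ℝ) (ha : 0 < amin) :
    ∃ δ₀ c₀ : ℝ, 0 < δ₀ ∧ 0 < c₀ ∧ ∀ (k : ℕ), 1 ≤ k → ∀ (a m2 : ℝ), amin ≤ a → a ≤ aplus → 0 ≤ m2 →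
      m2 ≤ m2plus → ∀ (M : Fin (d + 1) → ℕ), (∀ i, 1 ≤ M i) →
        ∀ (μ : Fin (d + 1)) (x' : ↥(boxDom (fun i => (ℓ + 1) ^ k * M i))),
          ∑ x, |(((ℓ + 1) ^ k : ℕ) : ℝ) *
                ((boxOpR ((ℓ + 1) ^ k) (B1.aSeq a ((ℓ : ℝ) + 1) k) m2 M)⁻¹ x'
                    (fwd (fun i => (ℓ + 1) ^ k * M i) μ x)
                  - (boxOpR ((ℓ + 1) ^ k) (B1.aSeq a ((ℓ : ℝ) + 1) k) m2 M)⁻¹ x' x)|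
              * Real.exp (δ₀ * supNorm (x'.1 - x.1) / (((ℓ + 1) ^ k : ℕ) : ℝ)) ≤ c₀ := by
  obtain ⟨δ₀, c₀, hδ, hc, h⟩ := Gfine_colwD_bound d ℓ hℓ amin aplus m2plus ha
  refine ⟨δ₀, c₀, hδ, hc, fun k hk a m2 h1 h2 h3 h4 M hM μ x' => ?_⟩
  have hG : Gfine ℓ k M k a m2 = (boxOpR ((ℓ + 1) ^ k) (B1.aSeq a ((ℓ : ℝ) + 1) k) m2 M)⁻¹ := by
    unfold Gfine
    rw [fineOp_top]
  have := h k hk k hk le_rfl a m2 h1 h2 h3 h4 M hM μ x'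
  rw [wsum, hG] at this
  exact this

/-! ## §6 The printed forms: (2.17) for `G_k(□)∂^{η*}_μ` at `p = q = ∞` and for `∂^η_μG_k(□)` at `p = q = 1`,
the pairing identity, and the literal-`a` versions -/

section Corollaries

variable {N : Fin (d + 1) → ℕ}

/-- **THE PAIRING IDENTITY** `⟨g, T∂^*_μf⟩ = ⟨∂_μ(Tg), f⟩` for a symmetric kernel `T`: the operator with kernel
`(x′, x) ↦ t(T(x′, fwd_μ x) − T(x′, x))` is the adjoint of `f ↦ ∂_μ(Tf)` (`(∂_μφ)(x) = t(φ(fwd_μ x) − φ(x))`) — the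
dictionary check that the kernel bounded below is that of `G_k(□)∂^{η*}_μ`. [folklore] -/
theorem Gdstar_pairing (T : Matrix ↥(boxDom N) ↥(boxDom N) ℝ) (hT : T.IsSymm) (μ : Fin (d + 1)) (t : ℝ)
    (f g : ↥(boxDom N) → ℝ) :
    ∑ x', g x' * ∑ x, t * (T x' (fwd N μ x) - T x' x) * f x
      = ∑ x, f x * (t * ((T *ᵥ g) (fwd N μ x) - (T *ᵥ g) x)) := by
  have hmv : ∀ z : ↥(boxDom N), (T *ᵥ g) z = ∑ x', T z x' * g x' := fun z => rfl
  simp_rw [hmv, Finset.mul_sum]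
  rw [Finset.sum_comm]
  refine Finset.sum_congr rfl fun x _ => ?_
  rw [← Finset.sum_sub_distrib, Finset.mul_sum, Finset.mul_sum]
  refine Finset.sum_congr rfl fun x' _ => ?_
  rw [hT.apply x' (fwd N μ x), hT.apply x' x]
  ring

/-- **(2.17) for `G_k(□)∂^{η*}_μ`, `p = q = ∞`, kernel form** (row sums of the kernel `η^{-1}(G(x′, fwd_μ x) − G(x′, x))`
over the bond variable): `Σ_x |L^k(G(x′, fwd_μ x) − G(x′, x))| ≤ c₀`, uniformly in `k ≥ 1`, the box, `μ` and `x′`.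
[cite: Balaban1983RegularityDecay, pp. 577–578 Lemma 2.2 (2.17); p. 583 (2.41)] -/
theorem lemma22_zero_box_Gdstar_rowSum (d ℓ : ℕ) (hℓ : 1 ≤ ℓ) (amin aplus m2plus : ℝ) (ha : 0 < amin) :
    ∃ c₀ : ℝ, 0 < c₀ ∧ ∀ (k : ℕ), 1 ≤ k → ∀ (a m2 : ℝ), amin ≤ a → a ≤ aplus → 0 ≤ m2 →
      m2 ≤ m2plus → ∀ (M : Fin (d + 1) → ℕ), (∀ i, 1 ≤ M i) →
        ∀ (μ : Fin (d + 1)) (x' : ↥(boxDom (fun i => (ℓ + 1) ^ k * M i))),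
          ∑ x, |(((ℓ + 1) ^ k : ℕ) : ℝ) *
              ((boxOpR ((ℓ + 1) ^ k) (B1.aSeq a ((ℓ : ℝ) + 1) k) m2 M)⁻¹ x'
                  (fwd (fun i => (ℓ + 1) ^ k * M i) μ x)
                - (boxOpR ((ℓ + 1) ^ k) (B1.aSeq a ((ℓ : ℝ) + 1) k) m2 M)⁻¹ x' x)| ≤ c₀ := by
  obtain ⟨δ₀, c₀, hδ, hc, h⟩ := lemma22_zero_box_Gdstar_roww d ℓ hℓ amin aplus m2plus ha
  refine ⟨c₀, hc, fun k hk a m2 h1 h2 h3 h4 M hM μ x' => ?_⟩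
  have hw := h k hk a m2 h1 h2 h3 h4 M hM μ x'
  exact (sum_abs_le_wsum hδ.le ((ℓ + 1) ^ k) x' _).trans hw

/-- **(2.17)/(2.41) for `G_k(□)∂^{η*}_μ`, `p = q = ∞`, operator form with the decay of the Remark on p. 583**:
`|(G_k(□)∂^{η*}_μf)(x′)| = |Σ_x L^k(G(x′, fwd_μ x) − G(x′, x))f(x)| ≤ c₀·e^{−δ₀ηD}·F` for every `f` on the sites (bond
functions: `f(x)` = the value on `⟨x, x + ηe_μ⟩`; sites without a forward bond contribute `0`), every `F ≥ |f|` pointwise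
and every `D ≤ |x′ − x|_∞ (x ∈ supp f)`. [cite: Balaban1983RegularityDecay, pp. 577–578 Lemma 2.2 (2.17); p. 583 (2.41), Remark] -/
theorem lemma22_zero_box_Gdstar_dist (d ℓ : ℕ) (hℓ : 1 ≤ ℓ) (amin aplus m2plus : ℝ) (ha : 0 < amin) :
    ∃ δ₀ c₀ : ℝ, 0 < δ₀ ∧ 0 < c₀ ∧ ∀ (k : ℕ), 1 ≤ k → ∀ (a m2 : ℝ), amin ≤ a → a ≤ aplus → 0 ≤ m2 →
      m2 ≤ m2plus → ∀ (M : Fin (d + 1) → ℕ), (∀ i, 1 ≤ M i) →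
        ∀ (μ : Fin (d + 1)) (x' : ↥(boxDom (fun i => (ℓ + 1) ^ k * M i)))
          (f : ↥(boxDom (fun i => (ℓ + 1) ^ k * M i)) → ℝ) (F D : ℝ), (∀ x, |f x| ≤ F) →
          (∀ x, f x ≠ 0 → D ≤ supNorm (x'.1 - x.1)) →
          |∑ x, (((ℓ + 1) ^ k : ℕ) : ℝ) *
              ((boxOpR ((ℓ + 1) ^ k) (B1.aSeq a ((ℓ : ℝ) + 1) k) m2 M)⁻¹ x'
                  (fwd (fun i => (ℓ + 1) ^ k * M i) μ x)
                - (boxOpR ((ℓ + 1) ^ k) (B1.aSeq a ((ℓ : ℝ) + 1) k) m2 M)⁻¹ x' x) * f x|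
            ≤ c₀ * Real.exp (-(δ₀ * D / (((ℓ + 1) ^ k : ℕ) : ℝ))) * F := by
  obtain ⟨δ₀, c₀, hδ, hc, h⟩ := lemma22_zero_box_Gdstar_roww d ℓ hℓ amin aplus m2plus ha
  refine ⟨δ₀, c₀, hδ, hc, fun k hk a m2 h1 h2 h3 h4 M hM μ x' f F D hF hD => ?_⟩
  have hw := h k hk a m2 h1 h2 h3 h4 M hM μ x'
  rw [← wsum] at hw
  exact abs_sum_mul_le_of_wsum hδ.le ((ℓ + 1) ^ k) x' _ hw f hF hD

/-- **(2.17) for `G_k(□)∂^{η*}_μ`, `p = q = ∞`, operator form**: `|(G_k(□)∂^{η*}_μf)(x′)| ≤ c₀‖f‖_∞`.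
[cite: Balaban1983RegularityDecay, pp. 577–578 Lemma 2.2 (2.17); p. 583 (2.41)] -/
theorem lemma22_zero_box_Gdstar_sup (d ℓ : ℕ) (hℓ : 1 ≤ ℓ) (amin aplus m2plus : ℝ) (ha : 0 < amin) :
    ∃ c₀ : ℝ, 0 < c₀ ∧ ∀ (k : ℕ), 1 ≤ k → ∀ (a m2 : ℝ), amin ≤ a → a ≤ aplus → 0 ≤ m2 →
      m2 ≤ m2plus → ∀ (M : Fin (d + 1) → ℕ), (∀ i, 1 ≤ M i) →
        ∀ (μ : Fin (d + 1)) (x' : ↥(boxDom (fun i => (ℓ + 1) ^ k * M i)))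
          (f : ↥(boxDom (fun i => (ℓ + 1) ^ k * M i)) → ℝ) (F : ℝ), (∀ x, |f x| ≤ F) →
          |∑ x, (((ℓ + 1) ^ k : ℕ) : ℝ) *
              ((boxOpR ((ℓ + 1) ^ k) (B1.aSeq a ((ℓ : ℝ) + 1) k) m2 M)⁻¹ x'
                  (fwd (fun i => (ℓ + 1) ^ k * M i) μ x)
                - (boxOpR ((ℓ + 1) ^ k) (B1.aSeq a ((ℓ : ℝ) + 1) k) m2 M)⁻¹ x' x) * f x| ≤ c₀ * F := by
  obtain ⟨δ₀, c₀, hδ, hc, h⟩ := lemma22_zero_box_Gdstar_dist d ℓ hℓ amin aplus m2plus ha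
  refine ⟨c₀, hc, fun k hk a m2 h1 h2 h3 h4 M hM μ x' f F hF => ?_⟩
  have h0 := h k hk a m2 h1 h2 h3 h4 M hM μ x' f F 0 hF (fun x _ => supNorm_nonneg _)
  simpa using h0

/-- **(2.17) for `∂^η_μG_k(□)`, `p = q = 1`, kernel form** («by duality argument», here the symmetry of `G`): the sums of
the kernel `η^{-1}(G(fwd_μ x, x′) − G(x, x′))` of `∂^η_μG_k(□)` over the bond variable `x`, for a fixed column `x′`, are
`≤ c₀`, uniformly. [cite: Balaban1983RegularityDecay, pp. 577–578 Lemma 2.2 (2.17); p. 583] -/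
theorem lemma22_zero_box_deriv_colSum (d ℓ : ℕ) (hℓ : 1 ≤ ℓ) (amin aplus m2plus : ℝ) (ha : 0 < amin) :
    ∃ c₀ : ℝ, 0 < c₀ ∧ ∀ (k : ℕ), 1 ≤ k → ∀ (a m2 : ℝ), amin ≤ a → a ≤ aplus → 0 ≤ m2 →
      m2 ≤ m2plus → ∀ (M : Fin (d + 1) → ℕ), (∀ i, 1 ≤ M i) →
        ∀ (μ : Fin (d + 1)) (x' : ↥(boxDom (fun i => (ℓ + 1) ^ k * M i))),
          ∑ x, |(((ℓ + 1) ^ k : ℕ) : ℝ) *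
              ((boxOpR ((ℓ + 1) ^ k) (B1.aSeq a ((ℓ : ℝ) + 1) k) m2 M)⁻¹
                  (fwd (fun i => (ℓ + 1) ^ k * M i) μ x) x'
                - (boxOpR ((ℓ + 1) ^ k) (B1.aSeq a ((ℓ : ℝ) + 1) k) m2 M)⁻¹ x x')| ≤ c₀ := by
  obtain ⟨c₀, hc, h⟩ := lemma22_zero_box_Gdstar_rowSum d ℓ hℓ amin aplus m2plus ha
  refine ⟨c₀, hc, fun k hk a m2 h1 h2 h3 h4 M hM μ x' => ?_⟩
  have hS := boxOpR_inv_isSymm ((ℓ + 1) ^ k) (B1.aSeq a ((ℓ : ℝ) + 1) k) m2 M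
  have hrow := h k hk a m2 h1 h2 h3 h4 M hM μ x'
  refine le_of_eq_of_le (Finset.sum_congr rfl fun x _ => ?_) hrow
  rw [hS.apply (fwd (fun i => (ℓ + 1) ^ k * M i) μ x) x', hS.apply x x']

/-- **(2.17) for `∂^η_μG_k(□)`, `p = q = 1`, operator form**: `‖∂^η_μG_k(□)f‖_1 ≤ c₀‖f‖_1`, i.e.
`Σ_x |L^k((Gf)(fwd_μ x) − (Gf)(x))| ≤ c₀·Σ_{x′}|f(x′)|` (sum over the bonds of `□` on the left, over the sites on the
right; the common factor `η^d` of the `L^1(□)` norms cancels). [cite: Balaban1983RegularityDecay, pp. 577–578 Lemma 2.2 (2.17); p. 583] -/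
theorem lemma22_zero_box_deriv_l1 (d ℓ : ℕ) (hℓ : 1 ≤ ℓ) (amin aplus m2plus : ℝ) (ha : 0 < amin) :
    ∃ c₀ : ℝ, 0 < c₀ ∧ ∀ (k : ℕ), 1 ≤ k → ∀ (a m2 : ℝ), amin ≤ a → a ≤ aplus → 0 ≤ m2 →
      m2 ≤ m2plus → ∀ (M : Fin (d + 1) → ℕ), (∀ i, 1 ≤ M i) →
        ∀ (μ : Fin (d + 1)) (f : ↥(boxDom (fun i => (ℓ + 1) ^ k * M i)) → ℝ),
          ∑ x, |(((ℓ + 1) ^ k : ℕ) : ℝ) *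
              (((boxOpR ((ℓ + 1) ^ k) (B1.aSeq a ((ℓ : ℝ) + 1) k) m2 M)⁻¹ *ᵥ f)
                  (fwd (fun i => (ℓ + 1) ^ k * M i) μ x)
                - ((boxOpR ((ℓ + 1) ^ k) (B1.aSeq a ((ℓ : ℝ) + 1) k) m2 M)⁻¹ *ᵥ f) x)|
            ≤ c₀ * ∑ x', |f x'| := by
  obtain ⟨c₀, hc, h⟩ := lemma22_zero_box_deriv_colSum d ℓ hℓ amin aplus m2plus ha
  refine ⟨c₀, hc, fun k hk a m2 h1 h2 h3 h4 M hM μ f => ?_⟩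
  set G := (boxOpR ((ℓ + 1) ^ k) (B1.aSeq a ((ℓ : ℝ) + 1) k) m2 M)⁻¹ with hGdef
  have hcol := h k hk a m2 h1 h2 h3 h4 M hM μ
  calc ∑ x, |(((ℓ + 1) ^ k : ℕ) : ℝ) * ((G *ᵥ f) (fwd (fun i => (ℓ + 1) ^ k * M i) μ x) - (G *ᵥ f) x)|
      = ∑ x, |∑ x', (((ℓ + 1) ^ k : ℕ) : ℝ) *
            (G (fwd (fun i => (ℓ + 1) ^ k * M i) μ x) x' - G x x') * f x'| := by
        refine Finset.sum_congr rfl fun x _ => ?_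
        rw [mulVec_sub_mulVec]
    _ ≤ ∑ x, ∑ x', |(((ℓ + 1) ^ k : ℕ) : ℝ) *
            (G (fwd (fun i => (ℓ + 1) ^ k * M i) μ x) x' - G x x')| * |f x'| := by
        refine Finset.sum_le_sum fun x _ => ?_
        exact (Finset.abs_sum_le_sum_abs _ _).trans
          (le_of_eq (Finset.sum_congr rfl fun x' _ => abs_mul _ _))
    _ = ∑ x', |f x'| * ∑ x, |(((ℓ + 1) ^ k : ℕ) : ℝ) *
            (G (fwd (fun i => (ℓ + 1) ^ k * M i) μ x) x' - G x x')| := by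
        rw [Finset.sum_comm]
        refine Finset.sum_congr rfl fun x' _ => ?_
        rw [Finset.mul_sum]
        refine Finset.sum_congr rfl fun x _ => ?_
        ring
    _ ≤ ∑ x', |f x'| * c₀ :=
        Finset.sum_le_sum fun x' _ => mul_le_mul_of_nonneg_left (hcol x') (abs_nonneg _)
    _ = c₀ * ∑ x', |f x'| := by rw [← Finset.sum_mul, mul_comm]

/-- **THE MASTER ESTIMATE FOR THE OPERATOR WITH THE LITERAL COEFFICIENT `a` OF (1.6)** ranging over a window
`[a₋, a₊]`, `a₋ > 0` (instead of the running `a_k`): by `B4Thm110ZeroBox.aSeq_div_cK`, `a = a_k(a/c_k(a))` with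
`a/c_k(a)` in a `k`-independent window. [cite: Balaban1983RegularityDecay, pp. 577–578 Lemma 2.2 (2.17); p. 572 (1.6)] -/
theorem lemma22_zero_box_Gdstar_roww_coeff (d ℓ : ℕ) (hℓ : 1 ≤ ℓ) (amin aplus m2plus : ℝ) (ha : 0 < amin) :
    ∃ δ₀ c₀ : ℝ, 0 < δ₀ ∧ 0 < c₀ ∧ ∀ (k : ℕ), 1 ≤ k → ∀ (a m2 : ℝ), amin ≤ a → a ≤ aplus → 0 ≤ m2 →
      m2 ≤ m2plus → ∀ (M : Fin (d + 1) → ℕ), (∀ i, 1 ≤ M i) →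
        ∀ (μ : Fin (d + 1)) (x' : ↥(boxDom (fun i => (ℓ + 1) ^ k * M i))),
          ∑ x, |(((ℓ + 1) ^ k : ℕ) : ℝ) *
                ((boxOpR ((ℓ + 1) ^ k) a m2 M)⁻¹ x' (fwd (fun i => (ℓ + 1) ^ k * M i) μ x)
                  - (boxOpR ((ℓ + 1) ^ k) a m2 M)⁻¹ x' x)|
              * Real.exp (δ₀ * supNorm (x'.1 - x.1) / (((ℓ + 1) ^ k : ℕ) : ℝ)) ≤ c₀ := by
  obtain ⟨δ₀, c₀, hδ0, hc0, h⟩ :=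
    lemma22_zero_box_Gdstar_roww d ℓ hℓ amin (aplus / (1 - ((((ℓ : ℝ) + 1)) ^ 2)⁻¹)) m2plus ha
  refine ⟨δ₀, c₀, hδ0, hc0, ?_⟩
  intro k hk a m2 h1 h2 h3 h4 M hM μ x'
  obtain ⟨hr0, hr1⟩ := Linv_sq_bounds hℓ
  have hc := cK_pos hℓ hk
  have hA1 : amin ≤ a / cK ℓ k := by
    rw [le_div_iff₀ hc]
    calc amin * cK ℓ k ≤ amin * 1 := mul_le_mul_of_nonneg_left (cK_le_one hℓ hk) ha.le
      _ ≤ a := by linarith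
  have hA2 : a / cK ℓ k ≤ aplus / (1 - ((((ℓ : ℝ) + 1)) ^ 2)⁻¹) :=
    div_le_div₀ (by linarith) h2 (by linarith) (oneSub_le_cK hℓ hk)
  have := h k hk (a / cK ℓ k) m2 hA1 hA2 h3 h4 M hM μ x'
  rwa [aSeq_div_cK hℓ hk] at this

/-- and `‖∂^η_μG_k(□)f‖_1 ≤ c₀‖f‖_1` for the operator with the literal coefficient `a` of (1.6).
[cite: Balaban1983RegularityDecay, pp. 577–578 Lemma 2.2 (2.17); p. 572 (1.6)] -/
theorem lemma22_zero_box_deriv_l1_coeff (d ℓ : ℕ) (hℓ : 1 ≤ ℓ) (amin aplus m2plus : ℝ) (ha : 0 < amin) :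
    ∃ c₀ : ℝ, 0 < c₀ ∧ ∀ (k : ℕ), 1 ≤ k → ∀ (a m2 : ℝ), amin ≤ a → a ≤ aplus → 0 ≤ m2 →
      m2 ≤ m2plus → ∀ (M : Fin (d + 1) → ℕ), (∀ i, 1 ≤ M i) →
        ∀ (μ : Fin (d + 1)) (f : ↥(boxDom (fun i => (ℓ + 1) ^ k * M i)) → ℝ),
          ∑ x, |(((ℓ + 1) ^ k : ℕ) : ℝ) *
              (((boxOpR ((ℓ + 1) ^ k) a m2 M)⁻¹ *ᵥ f) (fwd (fun i => (ℓ + 1) ^ k * M i) μ x)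
                - ((boxOpR ((ℓ + 1) ^ k) a m2 M)⁻¹ *ᵥ f) x)| ≤ c₀ * ∑ x', |f x'| := by
  obtain ⟨c₀, hc0, h⟩ :=
    lemma22_zero_box_deriv_l1 d ℓ hℓ amin (aplus / (1 - ((((ℓ : ℝ) + 1)) ^ 2)⁻¹)) m2plus ha
  refine ⟨c₀, hc0, ?_⟩
  intro k hk a m2 h1 h2 h3 h4 M hM μ f
  obtain ⟨hr0, hr1⟩ := Linv_sq_bounds hℓ
  have hc := cK_pos hℓ hk
  have hA1 : amin ≤ a / cK ℓ k := by
    rw [le_div_iff₀ hc]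
    calc amin * cK ℓ k ≤ amin * 1 := mul_le_mul_of_nonneg_left (cK_le_one hℓ hk) ha.le
      _ ≤ a := by linarith
  have hA2 : a / cK ℓ k ≤ aplus / (1 - ((((ℓ : ℝ) + 1)) ^ 2)⁻¹) :=
    div_le_div₀ (by linarith) h2 (by linarith) (oneSub_le_cK hℓ hk)
  have := h k hk (a / cK ℓ k) m2 hA1 hA2 h3 h4 M hM μ f
  rwa [aSeq_div_cK hℓ hk] at this

end Corollaries

/-! ## §7 Non-vacuity: the statements instantiated, their binders inhabited -/

/-- the master estimate at `d + 1 = 4`, `L = 2`, window `a ∈ [1/2, 2]`, `m² ∈ [0, 1]`, used at `k = 1`, the unit cube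
`M = 1`, axis `0` and the base site `0`: the bound `c₀` is a genuine number `≥` a genuine nonnegative sum. [folklore] -/
example : ∃ δ₀ c₀ : ℝ, 0 < δ₀ ∧ 0 < c₀ ∧
    ∑ x, |(((1 + 1) ^ 1 : ℕ) : ℝ) *
          ((boxOpR (d := 3) ((1 + 1) ^ 1) (B1.aSeq 1 ((1 : ℕ) + 1 : ℝ) 1) 0 (fun _ => 1))⁻¹
              ⟨0, mem_boxDom.2 fun _ => ⟨le_rfl, by norm_num⟩⟩
              (fwd (fun i => (1 + 1) ^ 1 * (fun _ => 1) i) 0 x)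
            - (boxOpR (d := 3) ((1 + 1) ^ 1) (B1.aSeq 1 ((1 : ℕ) + 1 : ℝ) 1) 0 (fun _ => 1))⁻¹
              ⟨0, mem_boxDom.2 fun _ => ⟨le_rfl, by norm_num⟩⟩ x)|
        * Real.exp (δ₀ * supNorm ((⟨0, mem_boxDom.2 fun _ => ⟨le_rfl, by norm_num⟩⟩ :
            ↥(boxDom (fun i => (1 + 1) ^ 1 * (fun _ => (1 : ℕ)) i))).1 - x.1) / (((1 + 1) ^ 1 : ℕ) : ℝ))
      ≤ c₀ := by
  obtain ⟨δ₀, c₀, hδ, hc, h⟩ := lemma22_zero_box_Gdstar_roww 3 1 le_rfl (1 / 2) 2 1 (by norm_num)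
  exact ⟨δ₀, c₀, hδ, hc, h 1 le_rfl 1 0 (by norm_num) (by norm_num) le_rfl (by norm_num) (fun _ => 1)
    (fun _ => le_rfl) 0 _⟩

/-- and the `L^1 → L^1` bound of `∂^η_0G_1(□)` on the same cube applied to the function `f ≡ 1`. [folklore] -/
example : ∃ c₀ : ℝ, 0 < c₀ ∧
    ∑ x, |(((1 + 1) ^ 1 : ℕ) : ℝ) *
        (((boxOpR (d := 3) ((1 + 1) ^ 1) (B1.aSeq 1 ((1 : ℕ) + 1 : ℝ) 1) 0 (fun _ => 1))⁻¹ *ᵥ fun _ => (1 : ℝ))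
            (fwd (fun i => (1 + 1) ^ 1 * (fun _ => 1) i) 0 x)
          - ((boxOpR (d := 3) ((1 + 1) ^ 1) (B1.aSeq 1 ((1 : ℕ) + 1 : ℝ) 1) 0 (fun _ => 1))⁻¹ *ᵥ fun _ => (1 : ℝ)) x)|
      ≤ c₀ * ∑ x' : ↥(boxDom (d := 3) (fun i => (1 + 1) ^ 1 * (fun _ => (1 : ℕ)) i)), |(fun _ => (1 : ℝ)) x'| := by
  obtain ⟨c₀, hc, h⟩ := lemma22_zero_box_deriv_l1 3 1 le_rfl (1 / 2) 2 1 (by norm_num)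
  exact ⟨c₀, hc, h 1 le_rfl 1 0 (by norm_num) (by norm_num) le_rfl (by norm_num) (fun _ => 1) (fun _ => le_rfl) 0 _⟩

end

end Literature.MathematicalPhysics.QuantumFieldTheory.Balaban1983to89.B4Lemma22ZeroBoxDerivDual
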